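/-
Copyright (c) 2026 the pub-hodgecm-mathlib formalisation cell (harness21).  Prover seat hodgecm-mathlib-LH4-p02 (g5), 2026-09-02: «TRACE GRAM ∕ DUAL COORDINATES AT A RAMIFIED CM
PLACE» (LH4-plan (g5) WORD #32 cut of the (B)(iv) census; the index HEAD `[O_j^# : O_j] = q_v^{d+2j}` is LH4-p01 (g4)'s `RamifiedPlaceOrderDualIndex`) — wild base layer, (D-RAM).
-/
import Literature.NumberTheory.Automorphic.RamifiedPlaceOrderAdditiveIndex   -- ★ p851167 (this seat): `exists_addSubgroup_*`, (ii)(iii); brings ★ MARS (`exp_neg_sq`), σ-DEPTH (`…_le_iff_mem_order`), ★ basis, ball index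
import Literature.NumberTheory.LocalFields.QuadraticLocalTracePlace          -- ★ p851136 (this seat): §4 `toPlace_trace_eq_add_galAdicCompletionMap` (`ι(Tr y) = y + σy`), `valued_trace_le_one_iff_valued_add_galAdicCompletionMap`; brings ★ p851014
import HarnessLib

/-!
# The TRACE GRAM of `(1, τ)` and the DUAL (trace) COORDINATES `y ↦ (Tr y, Tr(τ·y))` at a ramified CM place; the trace duals `O_j^#`, `𝒪_w^#` in these coordinates
# (Serre, *Local Fields* III §3, §6; Neukirch III §2; Cassels–Fröhlich I §4 — any residue characteristic)

Topic `NumberTheory/Automorphic`; namespace `Literature.NumberTheory.Automorphic.UnitaryGroup`.  THEOREMS ONLY (no definition, no instance, no notation, no named fact,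
no `sorry`; axioms ⊆ {propext, Classical.choice, Quot.sound}).  Cell `pub/hodgecm-mathlib` (D-0151), crux H413 = `stmt-HodgeConjecture-24833`; half A line LH4, DYADIC
pay-down leaf `Cruxes/H413/Lines/F0_P3c_DyadicPaydown.lean`, organ (D-RAM) (PRINT by ruling D74′; scope audit LH4-plan (g5) b4c7662647f1db69 «COVERED at v ∣ 2»).  HONEST
READER LABEL: BANKED base layer, consumers none live (a possible reader is LH4-p01 (g4)'s `RamifiedPlaceOrderDualIndex`, (B)(iv), which may equally prove its `O♯`-membership
step directly); HC_CM is proved only modulo the 7 printed citations (2 remaining named inputs: hLiu418 = stmt-HodgeConjecture-24832, h413 = stmt-HodgeConjecture-24833) until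
rung 0 closes; unconditional local algebra, count-neutral.

SETTING (= ★ `RamifiedPlaceOrderAdditiveIndex`).  `L` CM, `w ∣ v` with `c • w = w`, `e(w|v) ≠ 1`; `ι = toPlace v w`, `σ = σ_w`, `τ` a uniformiser with Eisenstein data
`τ + στ = ι u₀`, `τ·στ = −ι v₀`; `D = |στ − τ|`; `Tr = Algebra.trace L⁺_v L_w` (Mathlib, the `L⁺_v`-algebra structure found on `w.1.adicCompletion L` — the FLT-packet instance,
defeq to ★ `SemiLocal.algebraPlace` and to `toPlace`, see ★ `QuadraticLocalTracePlace` §4's instance note; `ι(Tr y) = y + σ y`).  The conductor-`j` order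
`O_j = {|x| ≤ 1, |σx − x| ≤ exp(−2j)·D}` (= `𝒪_v + ι ϖ_v^j·τ 𝒪_v`, ★ σ-DEPTH), its TRACE DUAL read σ-intrinsically `O_j^# = {y : ∀ x ∈ O_j, |x·y + σ(x·y)|_w ≤ 1}`, and
`𝒪_w^# = {|y|·D ≤ 1}` (★ `RamifiedPlaceTraceDual` §3).
* §1 THE GRAM ENTRIES AND THE DUAL COORDINATES: `trace_toPlace_add_toPlace_mul` (`Tr(ι p + ι q τ) = 2p + q u₀`), `trace_mul_toPlace_add_toPlace_mul`
  (`Tr(τ·(ι p + ι q τ)) = p u₀ + q (u₀² + 2v₀)`) — i.e. the Gram matrix of `(1, τ)` under the trace form is `[[2, u₀], [u₀, u₀² + 2v₀]]`, `det = u₀² + 4v₀` with `ι det = (τ − στ)²`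
  (cf. ★ `RamifiedPlaceOrderDiscriminant.valued_trace_sq_add_four_mul`: `|det|_v = |στ − τ|`) — and **`exists_trace_eq_and_trace_mul_eq`**: the dual coordinates `ψ y = (Tr y, Tr(τ·y))`
  are ONTO `L⁺_v²` (explicit Gram inverse; `det ≠ 0` because `τ ≠ στ` at a ramified place).
* §2 THE DUALS IN DUAL COORDINATES: `valued_toPlace_le_exp_iff` (`|ι t|_w ≤ exp(2m) ↔ |t|_v ≤ exp m`), **`forall_mem_order_imp_valued_add_le_one_iff`** — `y ∈ O_j^# ↔ |Tr y|_v ≤ 1 ∧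
  |Tr(τ·y)|_v ≤ exp(j)` (pairing integrally with the order ⟺ with its generators `1`, `ι ϖ_v^j·τ`), and **`valued_mul_le_one_iff_valued_trace_le`** — `|y|·D ≤ 1 ↔ |Tr y|_v ≤ 1 ∧
  |Tr(τ·y)|_v ≤ 1` (`𝒪_w^#`, the case `j = 0` combined with ★ `RamifiedPlaceTraceDual.forall_valued_add_galAdicCompletionMap_mul_le_one_iff`).  In these coordinates `𝒪_w^#` and `O_j^#`
  are the boxes `{|s| ≤ 1, |t| ≤ 1}` ⊆ `{|s| ≤ 1, |t| ≤ exp j}` of `L⁺_v²`; the index statements (`[O_j^# : 𝒪_w^#] = q_v^j`, `[O_j^# : O_j] = q_v^{d+2j}`) are NOT here (one writer: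
  LH4-p01 (g4), `RamifiedPlaceOrderDualIndex`).

## References
* [Serre1979] J.-P. Serre, *Local Fields*, GTM 67 (1979): Ch. III §3 (codifferent, trace form), Ch. III §6 (discriminant of a lattice), Ch. II §3.
* [NeukirchANT1999] J. Neukirch, *Algebraic Number Theory* (1999): Ch. III §2 (2.1)–(2.9) (complementary module, Gram determinant), Ch. I §12.
* [CasselsFrohlichANT1967] J. W. S. Cassels, A. Fröhlich (eds.), *Algebraic Number Theory* (1967), Ch. I (Fröhlich) §4 (dual module and discriminant).
-/

set_option autoImplicit false

noncomputable section

open NumberField IsDedekindDomain ValuativeRel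
open scoped ValuativeRel WithZero

namespace Literature.NumberTheory.Automorphic.UnitaryGroup

open Literature.NumberTheory.LocalFields (exists_addSubgroup_ball relIndex_ball_eq_pow)

variable (L : Type) [Field L] [NumberField L] [IsCMField L] (v : HeightOneSpectrum (𝓞 ↥(maximalRealSubfield L)))
  (w : PlacesOver L v) (hw : IsCMField.complexConj L • w.1 = w.1) (he : v.asIdeal.ramificationIdx' w.1.asIdeal ≠ 1)

/-! ## §1 The dual (trace) coordinates `y ↦ (Tr y, Tr(τ·y))` -/

/-- **`Tr(ι p + ι q·τ) = 2p + q·u₀`** for `τ + στ = ι u₀` (apply `ι`: `ι(Tr y) = y + σy`, ★ `QuadraticLocalTracePlace` §4). [cite: CasselsFrohlichANT1967, Ch. I §4] [cite: Serre1979, Ch. III §3] -/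
theorem trace_toPlace_add_toPlace_mul {τ : w.1.adicCompletion L} {u₀ : v.adicCompletion ↥(maximalRealSubfield L)}
    (htr : τ + galAdicCompletionMap (L := L) (IsCMField.complexConj L) hw τ = toPlace v w u₀) (p q : v.adicCompletion ↥(maximalRealSubfield L)) :
    Algebra.trace (v.adicCompletion ↥(maximalRealSubfield L)) (w.1.adicCompletion L) (toPlace v w p + toPlace v w q * τ) = 2 * p + q * u₀ := by
  apply (toPlace v w).injective
  rw [toPlace_trace_eq_add_galAdicCompletionMap L v w hw, galAdicCompletionMap_toPlace_add_toPlace_mul L v w hw τ p q, map_add, map_mul, map_mul, map_ofNat, ← htr]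
  ring

/-- **`Tr(τ·(ι p + ι q·τ)) = p·u₀ + q·(u₀² + 2v₀)`** for `τ + στ = ι u₀`, `τ·στ = −ι v₀` (`τ² + (στ)² = ι(u₀² + 2v₀)`). [cite: CasselsFrohlichANT1967, Ch. I §4] [cite: Serre1979, Ch. III §3] -/
theorem trace_mul_toPlace_add_toPlace_mul {τ : w.1.adicCompletion L} {u₀ v₀ : v.adicCompletion ↥(maximalRealSubfield L)}
    (htr : τ + galAdicCompletionMap (L := L) (IsCMField.complexConj L) hw τ = toPlace v w u₀)
    (hnm : τ * galAdicCompletionMap (L := L) (IsCMField.complexConj L) hw τ = -toPlace v w v₀) (p q : v.adicCompletion ↥(maximalRealSubfield L)) :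
    Algebra.trace (v.adicCompletion ↥(maximalRealSubfield L)) (w.1.adicCompletion L) (τ * (toPlace v w p + toPlace v w q * τ)) = p * u₀ + q * (u₀ ^ 2 + 2 * v₀) := by
  apply (toPlace v w).injective
  rw [toPlace_trace_eq_add_galAdicCompletionMap L v w hw, map_mul, galAdicCompletionMap_toPlace_add_toPlace_mul L v w hw τ p q, map_add, map_mul, map_mul, map_add,
    map_pow, map_mul, map_ofNat]
  have h2 : (τ + galAdicCompletionMap (L := L) (IsCMField.complexConj L) hw τ) ^ 2 = toPlace v w u₀ ^ 2 := by rw [htr]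
  have hsq : τ ^ 2 + galAdicCompletionMap (L := L) (IsCMField.complexConj L) hw τ ^ 2 = toPlace v w u₀ ^ 2 + 2 * toPlace v w v₀ := by
    linear_combination h2 - 2 * hnm
  linear_combination toPlace v w p * htr + toPlace v w q * hsq

include hw he in
/-- **THE DUAL COORDINATES ARE ONTO `L⁺_v²`**: for every `s t` there is `y ∈ L_w` with `Tr y = s`, `Tr(τ·y) = t` — the explicit Gram inverse of `(1, τ)` under the trace form,
`det = u₀² + 4v₀ ≠ 0` (`ι det = (τ − στ)²`, `τ ≠ στ` at a ramified place ★ `galAdicCompletionMap_ne_self_of_uniformizer`). [cite: Serre1979, Ch. III §3] [cite: NeukirchANT1999, Ch. III §2] -/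
theorem exists_trace_eq_and_trace_mul_eq {τ : w.1.adicCompletion L} (hτ : Valued.v τ = WithZero.exp (-1 : ℤ)) (s t : v.adicCompletion ↥(maximalRealSubfield L)) :
    ∃ y : w.1.adicCompletion L, Algebra.trace (v.adicCompletion ↥(maximalRealSubfield L)) (w.1.adicCompletion L) y = s ∧
      Algebra.trace (v.adicCompletion ↥(maximalRealSubfield L)) (w.1.adicCompletion L) (τ * y) = t := by
  obtain ⟨u₀, v₀, htr, hnm, -, -⟩ := exists_eisenstein_coeffs_of_ramified L v w hw he hτ
  -- `det = u₀² + 4 v₀ ≠ 0`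
  have hΔ : u₀ ^ 2 + 4 * v₀ ≠ 0 := by
    intro h0
    have hι : toPlace v w (u₀ ^ 2 + 4 * v₀) = (τ - galAdicCompletionMap (L := L) (IsCMField.complexConj L) hw τ) ^ 2 := by
      rw [map_add, map_pow, map_mul, map_ofNat, ← htr]
      linear_combination (4 : w.1.adicCompletion L) * hnm
    rw [h0, map_zero] at hι
    exact galAdicCompletionMap_ne_self_of_uniformizer L v w hw he hτ (sub_eq_zero.1 (pow_eq_zero_iff two_ne_zero |>.1 hι.symm)).symm
  refine ⟨toPlace v w (((u₀ ^ 2 + 2 * v₀) * s - u₀ * t) / (u₀ ^ 2 + 4 * v₀)) + toPlace v w ((2 * t - u₀ * s) / (u₀ ^ 2 + 4 * v₀)) * τ, ?_, ?_⟩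
  · rw [trace_toPlace_add_toPlace_mul L v w hw htr, mul_div_assoc', div_mul_eq_mul_div, ← add_div, div_eq_iff hΔ]
    ring
  · rw [trace_mul_toPlace_add_toPlace_mul L v w hw htr hnm, div_mul_eq_mul_div, div_mul_eq_mul_div, ← add_div, div_eq_iff hΔ]
    ring

/-! ## §2 The trace duals `O_j^#`, `𝒪_w^#` in dual coordinates -/

include hw he in
/-- `|ι t|_w ≤ exp(2m) ↔ |t|_v ≤ exp(m)` (`|ι t| = |t|²`). [cite: Serre1979, Ch. II §2] -/
theorem valued_toPlace_le_exp_iff (t : v.adicCompletion ↥(maximalRealSubfield L)) (m : ℤ) :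
    Valued.v (toPlace v w t) ≤ WithZero.exp (2 * m) ↔ Valued.v t ≤ WithZero.exp m := by
  rw [valued_toPlace_eq_sq_of_ramified L v w hw he, show WithZero.exp (2 * m) = WithZero.exp m ^ 2 by rw [← WithZero.exp_nsmul]; simp [two_mul],
    sq_le_sq_iff_withZero]

include he in
/-- **`O_j^#` IN DUAL COORDINATES**: for a uniformiser `τ`, a uniformiser `ϖ_v` of `L⁺_v`, `j : ℕ` and `y ∈ L_w`:
`(∀ x ∈ O_j, |x·y + σ(x·y)| ≤ 1) ↔ |Tr y|_v ≤ 1 ∧ |Tr(τ·y)|_v ≤ exp(j)` — pairing integrally with the order `O_j = 𝒪_v + ι ϖ_v^j τ·𝒪_v` (★ σ-DEPTH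
`valued_galAdicCompletionMap_sub_self_le_iff_mem_order`) is pairing integrally with its generators `1` and `ι ϖ_v^j·τ`. [cite: NeukirchANT1999, Ch. III §2] [cite: Serre1979, Ch. III §3] -/
theorem forall_mem_order_imp_valued_add_le_one_iff {τ : w.1.adicCompletion L} (hτ : Valued.v τ = WithZero.exp (-1 : ℤ)) (j : ℕ) (y : w.1.adicCompletion L) :
    (∀ x : w.1.adicCompletion L, Valued.v x ≤ 1 →
        Valued.v (galAdicCompletionMap (L := L) (IsCMField.complexConj L) hw x - x) ≤
          WithZero.exp (-(2 * j : ℤ)) * Valued.v (galAdicCompletionMap (L := L) (IsCMField.complexConj L) hw τ - τ) →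
        Valued.v (x * y + galAdicCompletionMap (L := L) (IsCMField.complexConj L) hw (x * y)) ≤ 1) ↔
      Valued.v (Algebra.trace (v.adicCompletion ↥(maximalRealSubfield L)) (w.1.adicCompletion L) y) ≤ 1 ∧
        Valued.v (Algebra.trace (v.adicCompletion ↥(maximalRealSubfield L)) (w.1.adicCompletion L) (τ * y)) ≤ WithZero.exp (j : ℤ) := by
  -- a uniformiser of `L⁺_v` and the generator `g = ι ϖ^j · τ`
  obtain ⟨π, hπ⟩ := v.valuation_exists_uniformizer ↥(maximalRealSubfield L)
  have hϖ : Valued.v (π : v.adicCompletion ↥(maximalRealSubfield L)) = WithZero.exp (-1 : ℤ) := by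
    rw [HeightOneSpectrum.valuedAdicCompletion_eq_valuation', hπ]
  set ϖ : v.adicCompletion ↥(maximalRealSubfield L) := (π : v.adicCompletion ↥(maximalRealSubfield L)) with hϖdef
  have hϖj : Valued.v (ϖ ^ j) = WithZero.exp (-(j : ℤ)) := by
    rw [map_pow, hϖ, ← WithZero.exp_nsmul]; simp
  have hD0 := valued_galAdicCompletionMap_sub_self_ne_zero L v w hw he hτ
  have htr := toPlace_trace_eq_add_galAdicCompletionMap L v w hw
  -- the σ-letter of the trace of `x·y` for `x = ι a + ι b τ`: `ι a·(y + σy) + ι b·(τy + σ(τy))`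
  have hlin : ∀ a b : v.adicCompletion ↥(maximalRealSubfield L),
      (toPlace v w a + toPlace v w b * τ) * y + galAdicCompletionMap (L := L) (IsCMField.complexConj L) hw ((toPlace v w a + toPlace v w b * τ) * y) =
        toPlace v w a * (y + galAdicCompletionMap (L := L) (IsCMField.complexConj L) hw y) +
          toPlace v w b * (τ * y + galAdicCompletionMap (L := L) (IsCMField.complexConj L) hw (τ * y)) := fun a b => by
    rw [map_mul, galAdicCompletionMap_toPlace_add_toPlace_mul L v w hw τ a b, map_mul]
    ring
  constructor
  · intro h
    constructor
    · -- `x = 1 ∈ O_j`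
      have h1 := h 1 (by rw [map_one]) (by rw [map_one, sub_self, map_zero]; exact zero_le)
      rw [one_mul] at h1
      rwa [valued_trace_le_one_iff_valued_add_galAdicCompletionMap L v w hw]
    · -- `x = ι ϖ^j · τ ∈ O_j`
      have hx1 : Valued.v (toPlace v w (ϖ ^ j) * τ) ≤ 1 := by
        rw [map_mul, valued_toPlace_eq_sq_of_ramified L v w hw he, hϖj, hτ, ← WithZero.exp_nsmul, ← WithZero.exp_add, ← WithZero.exp_zero, WithZero.exp_le_exp]
        simp only [nsmul_eq_mul, Nat.cast_ofNat]; omega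
      have hx2 : Valued.v (galAdicCompletionMap (L := L) (IsCMField.complexConj L) hw (toPlace v w (ϖ ^ j) * τ) - toPlace v w (ϖ ^ j) * τ) ≤
          WithZero.exp (-(2 * j : ℤ)) * Valued.v (galAdicCompletionMap (L := L) (IsCMField.complexConj L) hw τ - τ) := by
        have := valued_galAdicCompletionMap_sub_self_toPlace_add_toPlace_mul L v w hw he τ 0 (ϖ ^ j)
        rw [map_zero, zero_add] at this
        rw [this, hϖj, exp_neg_sq]
      have h2 := h _ hx1 hx2
      rw [show toPlace v w (ϖ ^ j) * τ * y = toPlace v w (ϖ ^ j) * (τ * y) by ring, map_mul, galAdicCompletionMap_toPlace (IsCMField.complexConj L) w w hw,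
        ← mul_add, ← htr, ← map_mul, valued_toPlace_eq_sq_of_ramified L v w hw he, sq_le_one_iff_withZero, map_mul, hϖj] at h2
      -- `exp(-j) · |Tr(τy)| ≤ 1 ↔ |Tr(τy)| ≤ exp(j)`
      calc Valued.v (Algebra.trace (v.adicCompletion ↥(maximalRealSubfield L)) (w.1.adicCompletion L) (τ * y))
          = WithZero.exp (j : ℤ) * (WithZero.exp (-(j : ℤ)) * Valued.v (Algebra.trace (v.adicCompletion ↥(maximalRealSubfield L)) (w.1.adicCompletion L) (τ * y))) := by
            rw [← mul_assoc, ← WithZero.exp_add, add_neg_cancel, WithZero.exp_zero, one_mul]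
        _ ≤ WithZero.exp (j : ℤ) * 1 := by gcongr
        _ = WithZero.exp (j : ℤ) := mul_one _
  · rintro ⟨h1, h2⟩ x hx hxj
    obtain ⟨a, b, ha, hb, rfl⟩ := (valued_galAdicCompletionMap_sub_self_le_iff_mem_order L v w hw he hτ hϖ j hx).1 hxj
    rw [hlin, ← htr, ← htr, ← map_mul, ← map_mul, ← map_add, valued_toPlace_eq_sq_of_ramified L v w hw he, sq_le_one_iff_withZero]
    refine (Valuation.map_add _ _ _).trans (max_le ?_ ?_)
    · rw [map_mul]
      calc Valued.v a * Valued.v (Algebra.trace (v.adicCompletion ↥(maximalRealSubfield L)) (w.1.adicCompletion L) y) ≤ 1 * 1 := by gcongr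
        _ = 1 := one_mul _
    · rw [map_mul, map_mul, hϖj]
      calc WithZero.exp (-(j : ℤ)) * Valued.v b * Valued.v (Algebra.trace (v.adicCompletion ↥(maximalRealSubfield L)) (w.1.adicCompletion L) (τ * y))
          ≤ WithZero.exp (-(j : ℤ)) * 1 * WithZero.exp (j : ℤ) := by gcongr
        _ = 1 := by rw [mul_one, ← WithZero.exp_add, neg_add_cancel, WithZero.exp_zero]

include he in
/-- **`𝒪_w^#` IN DUAL COORDINATES**: `|y|·|στ − τ| ≤ 1 ↔ |Tr y|_v ≤ 1 ∧ |Tr(τ·y)|_v ≤ 1` (★ `RamifiedPlaceTraceDual.forall_valued_add_galAdicCompletionMap_mul_le_one_iff`: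
`𝒪_w^# = {∀ x ∈ 𝒪_w, |x·y + σ(x·y)| ≤ 1}`, and §2 at `j = 0` — every `x ∈ 𝒪_w` has `|σx − x| ≤ D`, ★ `RamifiedPlaceDifferent` §6). [cite: Serre1979, Ch. III §3] [cite: NeukirchANT1999, Ch. III §2] -/
theorem valued_mul_le_one_iff_valued_trace_le {τ : w.1.adicCompletion L} (hτ : Valued.v τ = WithZero.exp (-1 : ℤ)) (y : w.1.adicCompletion L) :
    Valued.v y * Valued.v (galAdicCompletionMap (L := L) (IsCMField.complexConj L) hw τ - τ) ≤ 1 ↔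
      Valued.v (Algebra.trace (v.adicCompletion ↥(maximalRealSubfield L)) (w.1.adicCompletion L) y) ≤ 1 ∧
        Valued.v (Algebra.trace (v.adicCompletion ↥(maximalRealSubfield L)) (w.1.adicCompletion L) (τ * y)) ≤ 1 := by
  refine (forall_valued_add_galAdicCompletionMap_mul_le_one_iff L v w hw he hτ y).symm.trans ?_
  refine Iff.trans ?_ ((forall_mem_order_imp_valued_add_le_one_iff L v w hw he hτ 0 y).trans ?_)
  · -- every `x ∈ 𝒪_w` has σ-depth `≤ D = exp(−2·0)·D`
    refine forall_congr' fun x => ⟨fun h hx _ => h hx, fun h hx => h hx ?_⟩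
    rw [Nat.cast_zero, mul_zero, neg_zero, WithZero.exp_zero, one_mul]
    exact valued_galAdicCompletionMap_sub_self_le_of_mem_integer L v w hw he hτ hx
  · exact and_congr Iff.rfl (by rw [Nat.cast_zero, WithZero.exp_zero])

end Literature.NumberTheory.Automorphic.UnitaryGroup

end
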